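import Summits.FinalStateConjecture.FinalStateConjecture.Theorems.ClusterCompletenessOmegaLimitMultiKerrSettlesRecurs
import Summits.FinalStateConjecture.FinalStateConjecture.Theorems.PhaseMixingCaptureNearExtremalKappaCaptureThermalTimeStabilityCentre
import Literature.Geometry.Lorentzian.KerrConvergenceProofs
import HarnessLib

/-!
# Crux `ClusterCompleteness.OmegaLimitMultiKerr` (stmt-FinalStateConjecture-14664), line `Sketch` —
# the `N = 1` exact-Kerr certificate: the settle side modulo complete `𝓘⁺`

Registered stub `exists_exhaustiveDecomposition_kerrSlab_of` of the line lead (gen 2). The settle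
disjunct `Settles 𝒟` of the crux is "complete `𝓘⁺` AND an exhaustive sub-extremal final-state
decomposition `d` of the self-determined exterior `O = exteriorOf 𝒟 d.charted`". This file
certifies EVERY CLAUSE OF THAT DISJUNCT EXCEPT COMPLETE `𝓘⁺`, at every order `k` and with `N = 1`,
for the Kerr slab development `KerrSlab.development hM ha` of the exact sub-extremal Kerr data
(`0 < M`, `|a| < M`; carrier the slab domain `KerrSlab.domain a M ⊆ Kerr.region a M ⊆ E4`, so every
point `p` has ingoing Kerr–Schild coordinates `p.1.1`, time `t p = p.1.1 0` and radius
`r p = Kerr.radius a p.1.1`), GRANTED the same three facts about it as the recur-side assembly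
`recurs_kerrSlab_development_of` (supplied by the lead's other stubs, entering as hypotheses):

* (chart) an exact late chart `Ψ : Kerr.exterior M a → slab`: smooth, an open embedding on
  `{t* > 1}`, the identity in coordinates on `{t* ≥ 1}`, with metric deviation from `g_{M,a}`
  vanishing to all orders at every point of `E4` with `x⁰ > 1`;
* (helix) every point with `r > r₊`, `t > 0` lies in `J⁺` of the data, and from every point with
  `r > r₊`, `t ≥ 0` every later time `T` is reached at the same radius inside `I⁺` of the point;
* (exhaustion) a point in `I⁻({t > τ₀, r > r₊})` (`τ₀ ≥ 0`) has `r > r₊` and lies in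
  `J⁻({t = τ₁, r > r₊})` for every `τ₁ ≥ max τ₀ (t p)`.

Proof (DHRT arXiv:2104.08222, §1, the exterior `{t* ≥ τ₀}` of Kerr in ingoing Kerr–Schild
coordinates; Dafermos–Luk arXiv:1710.01722, Conjecture 1 and §1.2.1, the shape of the final
state): for each `k` we EXHIBIT an exhaustive ONE-hole `Cᵏ` final-state decomposition `d` of
`O := J⁺(Σ) ∩ I⁻(charted)` with label `(M, a)` (sub-extremal since `|a| < M`), `τ₀ = 1`, motion
`(1, 0)` (the boosted background of the trivial motion IS the Kerr background,
`boostedKerrBackground_one_zero`), hole chart the exact chart, excision `ρ t = max r₊ 0 + 1 + √t`,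
flat domain `U = {x⁰ > 1, r > ρ(x⁰)} ⊆ Kerr.exterior M a` with flat chart `Ψ|_U`
(`isLateChart_backgroundOn_comp_inclusion`, `tendsto_deviationCk_backgroundOn`); `O` is
`exteriorOf 𝒟 d.charted` by construction, and `HasExhaustiveCharts d` holds with radii
`R τ = ρ τ + 1`. Since `Ψ` is the identity in coordinates after time `1`, the charted set is
`{t > 1, r > r₊}` and every clause (late charts into `O`, the covering clause, exhaustion) is one of
the two hypotheses (helix)/(exhaustion) read through monotonicity of `I^±`, `J^±`. The construction
is literally that of `recurs_kerrSlab_development_of`, returned instead of being fed to the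
structure lemma `recurs_of_finalStateDecomposition`.
-/

-- every `Summit.FinalStateConjecture.FinalStateConjecture.…` name repeats the summit = sub-problem segment (D-0017 layout)
set_option linter.dupNamespace false

noncomputable section

open scoped Manifold ContDiff Topology ENNReal
open Set Filter TopologicalSpace Function

namespace Summit.FinalStateConjecture.FinalStateConjecture.Theorems.ClusterCompleteness

open Literature.Geometry.Lorentzian
open Summit.FinalStateConjecture.FinalStateConjecture.Theorems.NearExtremalKappaCapture.UnitTemperatureFrontFace

/-! ### Transport of a chart along an equality of reference backgrounds -/

/-- Bookkeeping for `boostedKerrBackground 1 0 M a = Kerr.background M a`: a chart on the Kerr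
background is a chart on any background EQUAL to it, with the same smoothness, the same
open-embedding property on late regions, the same images of late regions, slabs, truncated slabs
and growing near zones, and the same truncated deviations. [folklore] -/
private theorem exists_chart_of_eq_background {𝓢 : Spacetime 4} {M a : ℝ}
    (Ψ : (Kerr.background M a).domain → 𝓢.carrier) (B : ModelBackground)
    (hB : B = Kerr.background M a) :
    ∃ Ψ' : B.domain → 𝓢.carrier,
      (ContMDiff 𝓘(ℝ, E4) (𝓡 4) ∞ Ψ → ContMDiff 𝓘(ℝ, E4) (𝓡 4) ∞ Ψ') ∧
      (∀ τ : ℝ, Topology.IsOpenEmbedding ((Kerr.lateRegion M a τ).restrict Ψ) →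
        Topology.IsOpenEmbedding ((B.lateRegion τ).restrict Ψ')) ∧
      (∀ τ : ℝ, Ψ' '' B.lateRegion τ = Ψ '' Kerr.lateRegion M a τ) ∧
      (∀ τ : ℝ, Ψ' '' B.timeSlab τ = Ψ '' Kerr.timeSlab M a τ) ∧
      (∀ R τ : ℝ, Ψ' '' B.truncTimeSlab R τ = Ψ '' (Kerr.background M a).truncTimeSlab R τ) ∧
      (∀ (R : ℝ → ℝ) (τ₁ : ℝ),
        Ψ' '' {x | τ₁ < B.time x.1 ∧ B.radius x.1 ≤ R (B.time x.1)} =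
          Ψ '' {x | τ₁ < x.1 0 ∧ Kerr.radius a x.1 ≤ R (x.1 0)}) ∧
      ∀ (k : ℕ) (R τ : ℝ),
        𝓢.truncDeviationCk B Ψ' k R τ = 𝓢.truncDeviationCk (Kerr.background M a) Ψ k R τ := by
  subst hB
  exact ⟨Ψ, id, fun _ ↦ id, fun _ ↦ rfl, fun _ ↦ rfl, fun _ _ ↦ rfl, fun _ _ ↦ rfl,
    fun _ _ _ ↦ rfl⟩

/-- **STUB (decomposition).** Granted the exact chart, the helix facts and the exhaustion facts,
the Kerr slab development of the exact sub-extremal Kerr data carries, for every order `k`, an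
exhaustive ONE-hole `Cᵏ` final-state decomposition `d` of its self-determined exterior
`O = exteriorOf d.charted` with sub-extremal label `(M, a)` — i.e. every clause of the Statement's
settle disjunct except complete `𝓘⁺`. [folklore] -/
theorem exists_exhaustiveDecomposition_kerrSlab_of : ∀ [Kerr.Facts] [Kerr.SliceFacts] {M a : ℝ} (hM : 0 < M) (ha : |a| < M),
    (∃ Ψ : (Kerr.background M a).domain → (KerrSlab.development hM ha).carrier,
      ContMDiff 𝓘(ℝ, E4) (𝓡 4) ∞ Ψ ∧
      Topology.IsOpenEmbedding ((Kerr.lateRegion M a 1).restrict Ψ) ∧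
      (∀ x : (Kerr.background M a).domain, 1 ≤ x.1 0 → (Ψ x).1.1 = x.1) ∧
      ∀ z : E4, 1 < z 0 → ∀ m : ℕ,
        iteratedFDeriv ℝ m ((KerrSlab.development hM ha).toSpacetime.deviationExtend
          (Kerr.background M a) Ψ) z = 0) →
    ((∀ p : (KerrSlab.development hM ha).carrier,
      Kerr.rPlus M a < Kerr.radius a p.1.1 → 0 < p.1.1 0 →
        p ∈ (KerrSlab.development hM ha).metric.causalFuture
          (KerrSlab.development hM ha).timeOrientation (range (KerrSlab.development hM ha).embed)) ∧
    ∀ p : (KerrSlab.development hM ha).carrier,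
      Kerr.rPlus M a < Kerr.radius a p.1.1 → 0 ≤ p.1.1 0 → ∀ T : ℝ, p.1.1 0 < T →
        ∃ q : (KerrSlab.development hM ha).carrier,
          Kerr.radius a q.1.1 = Kerr.radius a p.1.1 ∧ q.1.1 0 = T ∧
            q ∈ (KerrSlab.development hM ha).metric.chronologicalFuture
              (KerrSlab.development hM ha).timeOrientation {p}) →
    (∀ {τ₀ : ℝ}, 0 ≤ τ₀ → ∀ {p : (KerrSlab.development hM ha).carrier},
      p ∈ (KerrSlab.development hM ha).metric.chronologicalPast
        (KerrSlab.development hM ha).timeOrientation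
          {q | τ₀ < q.1.1 0 ∧ Kerr.rPlus M a < Kerr.radius a q.1.1} →
      Kerr.rPlus M a < Kerr.radius a p.1.1 ∧
        ∀ τ₁ : ℝ, τ₀ ≤ τ₁ → p.1.1 0 ≤ τ₁ →
          p ∈ (KerrSlab.development hM ha).metric.causalPast
            (KerrSlab.development hM ha).timeOrientation
              {q | q.1.1 0 = τ₁ ∧ Kerr.rPlus M a < Kerr.radius a q.1.1}) →
    ∀ k : ℕ, ∃ (O : Set (KerrSlab.development hM ha).carrier)
      (d : FinalStateDecomposition (KerrSlab.development hM ha).toSpacetime O k),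
      d.N = 1 ∧ (∀ i, Kerr.IsSubextremal (d.mass i) (d.spin i)) ∧
        O = Summit.FinalStateConjecture.exteriorOf (KerrSlab.development hM ha).toCauchyDevelopment
          d.charted ∧ Summit.FinalStateConjecture.HasExhaustiveCharts d := by
  intro _ _ M a hM ha hchart hhelix hexh k
  set 𝒟 := KerrSlab.development hM ha
  obtain ⟨Ψ, hΨs, hΨe, hΨid, hΨ0⟩ := hchart
  obtain ⟨hJ, hfwd⟩ := hhelix
  /- (1) a point with `t ≥ 1`, `r > r₊` is the `Ψ`-image of its own coordinates -/
  have key : ∀ p : 𝒟.carrier, 1 ≤ p.1.1 0 → Kerr.rPlus M a < Kerr.radius a p.1.1 →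
      ∃ x : (Kerr.background M a).domain, x.1 = p.1.1 ∧ Ψ x = p := by
    intro p hp1 hpr
    have hx : p.1.1 ∈ Kerr.exterior M a :=
      Kerr.mem_exterior.2 (max_lt hpr (Kerr.radius_pos_of_mem_region p.1.2))
    exact ⟨⟨p.1.1, hx⟩, rfl, Subtype.ext (Subtype.ext (hΨid ⟨p.1.1, hx⟩ hp1))⟩
  -- the late sets `{t > τ, r > r₊}`, `τ ≥ 1`, are the images of the Kerr late regions
  have hlate_sub : ∀ τ : ℝ, 1 ≤ τ →
      {p : 𝒟.carrier | τ < p.1.1 0 ∧ Kerr.rPlus M a < Kerr.radius a p.1.1} ⊆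
        Ψ '' Kerr.lateRegion M a τ := by
    intro τ hτ p hp
    obtain ⟨x, hx, rfl⟩ := key p (hτ.trans hp.1.le) hp.2
    exact ⟨x, show τ < x.1 0 by rw [hx]; exact hp.1, rfl⟩
  have hsub_late : ∀ τ : ℝ, 1 ≤ τ → Ψ '' Kerr.lateRegion M a τ ⊆
      {p : 𝒟.carrier | τ < p.1.1 0 ∧ Kerr.rPlus M a < Kerr.radius a p.1.1} := by
    rintro τ hτ _ ⟨x, hx, rfl⟩
    have hx' : τ < x.1 0 := hx
    have hid : (Ψ x).1.1 = x.1 := hΨid x (hτ.trans hx'.le)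
    refine ⟨?_, ?_⟩
    · show τ < (Ψ x).1.1 0
      rw [hid]
      exact hx'
    · show Kerr.rPlus M a < Kerr.radius a (Ψ x).1.1
      rw [hid]
      exact Kerr.lt_radius_of_mem_region x.2
  have hslab_hole : {p : 𝒟.carrier | p.1.1 0 = 1 ∧ Kerr.rPlus M a < Kerr.radius a p.1.1} ⊆
      Ψ '' Kerr.timeSlab M a 1 := by
    intro p hp
    obtain ⟨x, hx, rfl⟩ := key p hp.1.ge hp.2
    exact ⟨x, show x.1 0 = 1 by rw [hx]; exact hp.1, rfl⟩
  have htrunc_hole : ∀ τ R : ℝ, 1 ≤ τ →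
      {p : 𝒟.carrier | p.1.1 0 = τ ∧ Kerr.rPlus M a < Kerr.radius a p.1.1 ∧
        Kerr.radius a p.1.1 ≤ R} ⊆ Ψ '' (Kerr.background M a).truncTimeSlab R τ := by
    intro τ R hτ p hp
    obtain ⟨x, hx, rfl⟩ := key p (by rw [hp.1]; exact hτ) hp.2.1
    exact ⟨x, ⟨show x.1 0 = τ by rw [hx]; exact hp.1,
      show Kerr.radius a x.1 ≤ R by rw [hx]; exact hp.2.2⟩, rfl⟩
  have hcert_hole : ∀ (R : ℝ → ℝ) (τ₁ : ℝ), 1 ≤ τ₁ →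
      {p : 𝒟.carrier | τ₁ < p.1.1 0 ∧ Kerr.rPlus M a < Kerr.radius a p.1.1 ∧
        Kerr.radius a p.1.1 ≤ R (p.1.1 0)} ⊆
        Ψ '' {x | τ₁ < x.1 0 ∧ Kerr.radius a x.1 ≤ R (x.1 0)} := by
    intro R τ₁ hτ₁ p hp
    obtain ⟨x, hx, rfl⟩ := key p (hτ₁.trans hp.1.le) hp.2.1
    exact ⟨x, ⟨show τ₁ < x.1 0 by rw [hx]; exact hp.1,
      show Kerr.radius a x.1 ≤ R (x.1 0) by rw [hx]; exact hp.2.2⟩, rfl⟩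
  /- (2) the deviation of the exact chart vanishes on every slab after time `1` -/
  have hdev0 : ∀ τ : ℝ, 1 < τ → 𝒟.toSpacetime.deviationCk (Kerr.background M a) Ψ k τ = 0 := by
    intro τ hτ
    refine le_antisymm ?_ zero_le
    unfold Spacetime.deviationCk supCkENorm
    refine iSup₂_le fun m _ ↦ iSup₂_le fun z hz ↦ ?_
    obtain ⟨x, hxτ, rfl⟩ := hz
    have hx0 : (x : E4) 0 = τ := hxτ
    rw [hΨ0 (x : E4) (by rw [hx0]; exact hτ) m, enorm_zero]
  have ht : Tendsto (fun τ ↦ 𝒟.toSpacetime.deviationCk (Kerr.background M a) Ψ k τ) atTop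
      (𝓝 0) :=
    tendsto_const_nhds.congr' (by
      filter_upwards [eventually_gt_atTop 1] with τ hτ using (hdev0 τ hτ).symm)
  /- (3) the hole chart, transported to the boosted background of the trivial motion -/
  obtain ⟨Ψ', hΨ's, hΨ'e, hΨ'late, hΨ'slab, hΨ'trunc, hΨ'cert, hΨ'dev⟩ :=
    exists_chart_of_eq_background Ψ (boostedKerrBackground 1 0 M a)
      (boostedKerrBackground_one_zero M a)
  replace hΨ's := hΨ's hΨs
  replace hΨ'e := hΨ'e 1 hΨe
  /- (4) the excision radius and the flat domain -/
  set C₀ : ℝ := max (Kerr.rPlus M a) 0 + 1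
  set ρ : ℝ → ℝ := fun t ↦ C₀ + √t with hρ
  have hρc : Continuous ρ := continuous_const.add Real.continuous_sqrt
  have hρC : ∀ t, C₀ ≤ ρ t := fun t ↦ le_add_of_nonneg_right (Real.sqrt_nonneg t)
  have hρr : ∀ t, Kerr.rPlus M a < ρ t := fun t ↦ by
    have h1 := hρC t
    have h2 := le_max_left (Kerr.rPlus M a) 0
    linarith
  have hρtop : Tendsto ρ atTop atTop := tendsto_atTop_add_const_left _ C₀ Real.tendsto_sqrt_atTop
  have hρdiv : Tendsto (fun t ↦ ρ t / t) atTop (𝓝 0) := by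
    have h1 : Tendsto (fun t : ℝ ↦ C₀ / t) atTop (𝓝 0) := tendsto_const_nhds.div_atTop tendsto_id
    have h2 : Tendsto (fun t : ℝ ↦ √t / t) atTop (𝓝 0) := by
      simp_rw [Real.sqrt_div_self]
      exact tendsto_inv_atTop_zero.comp Real.tendsto_sqrt_atTop
    simpa [hρ, add_div] using h1.add h2
  have hc0 : Continuous fun y : E4 ↦ y 0 := PiLp.continuous_apply 2 _ 0
  let U : Opens E4 := ⟨{x | 1 < x 0 ∧ ρ (x 0) < Kerr.radius a x},
    (isOpen_lt continuous_const hc0).inter (isOpen_lt (hρc.comp hc0) (Kerr.continuous_radius a))⟩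
  have hUK : (Minkowski.backgroundOn U).domain ≤ (Kerr.background M a).domain := by
    intro x hx
    change max (Kerr.rPlus M a) 0 < Kerr.radius a x
    have h2 : ρ (x 0) < Kerr.radius a x := hx.2
    have h3 := hρC (x 0)
    linarith
  have hUρ : ∀ z ∈ U, ρ (z 0) < Kerr.radius a z := fun z hz ↦ hz.2
  -- the flat chart `Ψ|_U`: images of its late regions and slabs
  have hflat_late : (Ψ ∘ Opens.inclusion hUK) '' (Minkowski.backgroundOn U).lateRegion 1 ⊆
      {p : 𝒟.carrier | 1 < p.1.1 0 ∧ Kerr.rPlus M a < Kerr.radius a p.1.1} := by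
    rintro _ ⟨x, hx, rfl⟩
    have hx' : 1 < x.1 0 := hx
    exact hsub_late 1 le_rfl ⟨Opens.inclusion hUK x, hx', rfl⟩
  have hlate_flat : ∀ τ : ℝ, 1 ≤ τ →
      {p : 𝒟.carrier | τ < p.1.1 0 ∧ ρ (p.1.1 0) < Kerr.radius a p.1.1} ⊆
        (Ψ ∘ Opens.inclusion hUK) '' (Minkowski.backgroundOn U).lateRegion τ := by
    intro τ hτ p hp
    obtain ⟨x, hx, rfl⟩ := key p (hτ.trans hp.1.le) ((hρr _).trans hp.2)
    have hxU : x.1 ∈ U :=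
      ⟨by rw [hx]; exact hτ.trans_lt hp.1, by rw [hx]; exact hp.2⟩
    exact ⟨⟨x.1, hxU⟩, show τ < x.1 0 by rw [hx]; exact hp.1, rfl⟩
  have hslab_flat : ∀ τ : ℝ, 1 < τ →
      {p : 𝒟.carrier | p.1.1 0 = τ ∧ ρ τ < Kerr.radius a p.1.1} ⊆
        (Ψ ∘ Opens.inclusion hUK) '' (Minkowski.backgroundOn U).timeSlab τ := by
    intro τ hτ p hp
    obtain ⟨x, hx, rfl⟩ := key p (by rw [hp.1]; exact hτ.le) ((hρr _).trans hp.2)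
    have hxU : x.1 ∈ U :=
      ⟨by rw [hx, hp.1]; exact hτ, by rw [hx, hp.1]; exact hp.2⟩
    exact ⟨⟨x.1, hxU⟩, show x.1 0 = τ by rw [hx]; exact hp.1, rfl⟩
  /- (5) the charted set `C = {t > 1, r > r₊}` and the exterior `O = J⁺(Σ) ∩ I⁻(C)` -/
  set C : Set 𝒟.carrier :=
    (Ψ ∘ Opens.inclusion hUK) '' (Minkowski.backgroundOn U).lateRegion 1 ∪
      ⋃ _i : Fin 1, Ψ' '' (boostedKerrBackground 1 0 M a).lateRegion 1
  set O : Set 𝒟.carrier := Summit.FinalStateConjecture.exteriorOf 𝒟.toCauchyDevelopment C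
  have hlateC : {p : 𝒟.carrier | 1 < p.1.1 0 ∧ Kerr.rPlus M a < Kerr.radius a p.1.1} ⊆ C :=
    fun p hp ↦ Or.inr (mem_iUnion.2 ⟨0, by rw [hΨ'late]; exact hlate_sub 1 le_rfl hp⟩)
  have hClate : C ⊆ {p : 𝒟.carrier | 1 < p.1.1 0 ∧ Kerr.rPlus M a < Kerr.radius a p.1.1} :=
    union_subset hflat_late (iUnion_subset fun _ ↦ by
      rw [hΨ'late]; exact hsub_late 1 le_rfl)
  have hlateO : {p : 𝒟.carrier | 1 < p.1.1 0 ∧ Kerr.rPlus M a < Kerr.radius a p.1.1} ⊆ O := by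
    intro p hp
    refine ⟨hJ p hp.2 (one_pos.trans hp.1), ?_⟩
    obtain ⟨q, hqr, hqt, hq⟩ :=
      hfwd p hp.2 (zero_le_one.trans hp.1.le) (p.1.1 0 + 1) (lt_add_one _)
    have hqC : q ∈ C := hlateC ⟨by rw [hqt]; linarith [hp.1], by rw [hqr]; exact hp.2⟩
    exact LorentzianMetric.chronologicalFuture_mono (τ := 𝒟.timeOrientation.reverse)
      (singleton_subset_iff.2 hqC)
      (LorentzianMetric.mem_chronologicalPast_of_mem_chronologicalFuture hq)
  -- a point of `I⁻(C)` has `r > r₊` and is causally below every slab `{t = τ₁, r > r₊}` above it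
  have hexhC : ∀ p : 𝒟.carrier, p ∈ O → Kerr.rPlus M a < Kerr.radius a p.1.1 ∧
      ∀ τ₁ : ℝ, 1 ≤ τ₁ → p.1.1 0 ≤ τ₁ → p ∈ 𝒟.metric.causalPast 𝒟.timeOrientation
        {q | q.1.1 0 = τ₁ ∧ Kerr.rPlus M a < Kerr.radius a q.1.1} := fun p hp ↦
    hexh zero_le_one
      (LorentzianMetric.chronologicalFuture_mono (τ := 𝒟.timeOrientation.reverse) hClate hp.2)
  /- (6) the late charts -/
  have hΨchart : 𝒟.toSpacetime.IsLateChart (Kerr.background M a) O 1 Ψ :=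
    ⟨hΨs, hΨe, (hsub_late 1 le_rfl).trans hlateO⟩
  have hΨ'chart : 𝒟.toSpacetime.IsLateChart (boostedKerrBackground 1 0 M a) O 1 Ψ' :=
    ⟨hΨ's, hΨ'e, by rw [hΨ'late]; exact (hsub_late 1 le_rfl).trans hlateO⟩
  have htrunc : ∀ R : ℝ → ℝ, Tendsto (fun τ ↦ 𝒟.toSpacetime.truncDeviationCk
      (boostedKerrBackground 1 0 M a) Ψ' k (R τ) τ) atTop (𝓝 0) := fun R ↦ by
    refine tendsto_of_tendsto_of_tendsto_of_le_of_le tendsto_const_nhds ht (fun _ ↦ zero_le)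
      fun τ ↦ ?_
    rw [hΨ'dev]
    exact 𝒟.toSpacetime.truncDeviationCk_le_deviationCk _ Ψ k _ τ
  /- (7) the covering clause at `τ₀ = 1` -/
  have hcov : O \ ((⋃ _i : Fin 1, Ψ' '' (boostedKerrBackground 1 0 M a).lateRegion 1) ∪
      (Ψ ∘ Opens.inclusion hUK) '' (Minkowski.backgroundOn U).lateRegion 1) ⊆
      𝒟.metric.causalPast 𝒟.timeOrientation
        ((⋃ _i : Fin 1, Ψ' '' (boostedKerrBackground 1 0 M a).timeSlab 1) ∪
          (Ψ ∘ Opens.inclusion hUK) '' (Minkowski.backgroundOn U).timeSlab 1) := by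
    rintro p ⟨hpO, hpn⟩
    obtain ⟨hpr, hpJ⟩ := hexhC p hpO
    have hpt : p.1.1 0 ≤ 1 := not_lt.1 fun h ↦ hpn (Or.inl (mem_iUnion.2 ⟨0, by
      rw [hΨ'late]; exact hlate_sub 1 le_rfl ⟨h, hpr⟩⟩))
    refine LorentzianMetric.causalFuture_mono (τ := 𝒟.timeOrientation.reverse) (fun q hq ↦ ?_)
      (hpJ 1 le_rfl hpt)
    exact Or.inl (mem_iUnion.2 ⟨0, by rw [hΨ'slab]; exact hslab_hole hq⟩)
  /- (8) the one-hole decomposition `d` with `τ₀ = 1` -/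
  have hUsub : {x : E4 | 1 < x 0 ∧ ∀ _i : Fin 1, ρ (x 0) < Kerr.radius a (poincareInv 1 0 x)} ⊆
      (U : Set E4) := fun x hx ↦ ⟨hx.1, by simpa using hx.2 0⟩
  have hflatchart := 𝒟.toSpacetime.isLateChart_backgroundOn_comp_inclusion hΨchart hUK
  have hflatdev := 𝒟.toSpacetime.tendsto_deviationCk_backgroundOn hΨs ht hρtop hUρ hUK
  let d : FinalStateDecomposition 𝒟.toSpacetime O k :=
    { N := 1
      mass := fun _ ↦ M
      spin := fun _ ↦ a
      mass_pos := fun _ ↦ hM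
      abs_spin_le_mass := fun _ ↦ ha.le
      motion := fun _ ↦ (1, 0)
      τ₀ := 1
      chart := fun _ ↦ Ψ'
      isLateChart := fun _ ↦ hΨ'chart
      tendsto_truncDeviationCk := fun _ R ↦ htrunc fun _ ↦ R
      exists_pairwise_disjoint := fun _ ↦ ⟨0, Subsingleton.pairwise⟩
      excision := fun _ ↦ ρ
      tendsto_excision_div := fun _ ↦ hρdiv
      flatDomain := U
      setOf_lt_excision_subset_flatDomain := hUsub
      flatChart := Ψ ∘ Opens.inclusion hUK
      isLateChart_flat := hflatchart
      tendsto_deviationCk_flat := hflatdev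
      diff_subset_causalPast := hcov }
  -- read-back of the certified late regions and slabs of `d` for the radii `ρ τ + 1`
  have hcL : ∀ τ₁ : ℝ, Summit.FinalStateConjecture.certifiedLate d (fun _ τ ↦ ρ τ + 1) τ₁ =
      (Ψ ∘ Opens.inclusion hUK) '' (Minkowski.backgroundOn U).lateRegion τ₁ ∪
        ⋃ _i : Fin 1, Ψ '' {x | τ₁ < x.1 0 ∧ Kerr.radius a x.1 ≤ ρ (x.1 0) + 1} := fun τ₁ ↦ by
    rw [← hΨ'cert (fun τ ↦ ρ τ + 1) τ₁]
    rfl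
  have hcS : ∀ τ₁ : ℝ, Summit.FinalStateConjecture.certifiedSlab d (fun _ τ ↦ ρ τ + 1) τ₁ =
      (Ψ ∘ Opens.inclusion hUK) '' (Minkowski.backgroundOn U).timeSlab τ₁ ∪
        ⋃ _i : Fin 1, Ψ '' (Kerr.background M a).truncTimeSlab (ρ τ₁ + 1) τ₁ := fun τ₁ ↦ by
    rw [← hΨ'trunc]
    rfl
  /- (9) return `O`, `d`; exhaustion at `τ₁ > 1` with radii `ρ τ + 1` -/
  -- buildfix 2026-08-20 (proof-only): the audit-g6 `HasExhaustiveCharts` also asks the radii `ρ τ + 1`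
  -- to grow (`√τ → ∞`) and to dominate `max r₊ 0 + 1 = C₀ ≤ ρ τ`.
  refine ⟨O, d, rfl, fun _ ↦ ha, rfl,
    ⟨fun _ τ ↦ ρ τ + 1,
      fun _ ↦ ⟨tendsto_atTop_add_const_right _ _ hρtop,
        fun τ ↦ (hρC τ).trans (le_add_of_nonneg_right zero_le_one)⟩,
      fun _ ↦ htrunc fun τ ↦ ρ τ + 1, fun τ₁ hτ₁ ↦ ?_⟩⟩
  have hτ₁' : (1 : ℝ) < τ₁ := hτ₁
  rw [hcL, hcS]
  rintro p ⟨hpO, hpn⟩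
  obtain ⟨hpr, hpJ⟩ := hexhC p hpO
  -- `t p ≤ τ₁`: later points are certified (hole part if `r ≤ ρ t + 1`, flat part otherwise)
  have hpt : p.1.1 0 ≤ τ₁ := by
    refine not_lt.1 fun h ↦ hpn ?_
    rcases le_or_gt (Kerr.radius a p.1.1) (ρ (p.1.1 0) + 1) with hle | hlt
    · exact Or.inr (mem_iUnion.2 ⟨0, hcert_hole (fun τ ↦ ρ τ + 1) τ₁ hτ₁'.le ⟨h, hpr, hle⟩⟩)
    · exact Or.inl (hlate_flat τ₁ hτ₁'.le ⟨h, (lt_add_one _).trans hlt⟩)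
  refine LorentzianMetric.causalFuture_mono (τ := 𝒟.timeOrientation.reverse) (fun q hq ↦ ?_)
    (hpJ τ₁ hτ₁'.le hpt)
  rcases le_or_gt (Kerr.radius a q.1.1) (ρ τ₁ + 1) with hle | hlt
  · exact Or.inr (mem_iUnion.2 ⟨0, htrunc_hole τ₁ _ hτ₁'.le ⟨hq.1, hq.2, hle⟩⟩)
  · exact Or.inl (hslab_flat τ₁ hτ₁' ⟨hq.1, (lt_add_one _).trans hlt⟩)

end Summit.FinalStateConjecture.FinalStateConjecture.Theorems.ClusterCompleteness

end
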